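import Mathlib.Analysis.InnerProductSpace.Adjoint
import Mathlib.Analysis.InnerProductSpace.PiL2
import HarnessLib

/-!
# Traces of bilinear maps in a frame orthonormal for `⟪G ·, ·⟫`

Topic `Literature/Geometry/Riemannian` (linear algebra for the nonparametric description of
submanifolds, White 2005 §8.4).  Let `E` be a finite-dimensional real inner product space,
`G : E →L E` a symmetric operator with `⟪G v, v⟫ > 0` for `v ≠ 0` (the Gram operator
`G = 1 + D†D` of a graph map `L + u`, `D = Du`), `b` a basis with `⟪G bᵢ, bⱼ⟫ = δᵢⱼ` (an
orthonormal frame of the induced metric) and `e` an orthonormal basis of `E`.  For every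
continuous bilinear `B : E →L E →L F`,

  `∑ᵢ B bᵢ bᵢ = ∑ⱼ B (G⁻¹ eⱼ) eⱼ`       (`sum_frame_eq_sum_inverse_apply`),

the basis-free form of `∑ᵢ D²u(bᵢ, bᵢ) = g^{jk} ∂²_{jk} u`.  For the graph Gram operator
`G = 1 + D†D` we record invertibility, `‖G⁻¹‖ ≤ 1`, `‖G⁻¹ - 1‖ ≤ ‖D‖²` and the Lipschitz
estimate `‖G_D⁻¹ - G_{D'}⁻¹‖ ≤ (‖D‖ + ‖D'‖) ‖D - D'‖` (resolvent identity), the inputs for the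
Hölder smallness of `∑ᵢ D²u(bᵢ, bᵢ) - Δu` as `Du → 0`; and the orthogonal projection onto the
graph tangent space `T = range (L + D)`, `P_T = (L + D) G⁻¹ (L + D)†`
(`starProjection_range_graph_eq`), `12`-Lipschitz in `D` on `‖D‖ ≤ 1`
(`norm_graphProjection_sub_le`).

Everything is PROVED; no definitions, no named facts.

## References

* B. White, *A local regularity theorem for mean curvature flow*, Ann. of Math. 161 (2005),
  §8.4 (the coefficients `g^{ij}(Du)`). [White2005]
-/

noncomputable section

namespace Literature.Geometry.Riemannian

open scoped RealInnerProductSpace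
open Module

variable {E F : Type*} [NormedAddCommGroup E] [InnerProductSpace ℝ E] [FiniteDimensional ℝ E]
  [NormedAddCommGroup F] [NormedSpace ℝ F]

omit [FiniteDimensional ℝ E] in
/-- Expansion in a `G`-orthonormal frame: if `⟪G bᵢ, bⱼ⟫ = δᵢⱼ` then `v = ∑ᵢ ⟪v, G bᵢ⟫ bᵢ`.
[folklore] -/
theorem eq_sum_inner_frame {ι : Type*} [Fintype ι] [DecidableEq ι] {G : E →L[ℝ] E}
    (b : Basis ι ℝ E)
    (hb : ∀ i j, ⟪G (b i), b j⟫ = if i = j then 1 else 0) (v : E) :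
    v = ∑ i, ⟪v, G (b i)⟫ • b i := by
  -- compare coefficients in the basis `b`: pair with `G bⱼ`
  have hb' : ∀ i j, ⟪b i, G (b j)⟫ = if j = i then 1 else 0 := fun i j =>
    (real_inner_comm (G (b j)) (b i)).trans (hb j i)
  have key : ∀ w : E, (∀ j, ⟪w, G (b j)⟫ = 0) → w = 0 := by
    intro w hw
    -- write `w = ∑ cᵢ bᵢ`; pairing with `G bⱼ` gives `cⱼ = 0`
    have hrepr := b.sum_repr w
    have hc : ∀ j, b.repr w j = 0 := fun j => by
      have h := hw j
      rw [← hrepr, sum_inner] at h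
      simp_rw [real_inner_smul_left, hb'] at h
      simpa [Finset.sum_ite_eq, Finset.mem_univ] using h
    rw [← hrepr]
    simp [hc]
  have h : ∀ j, ⟪v - ∑ i, ⟪v, G (b i)⟫ • b i, G (b j)⟫ = 0 := fun j => by
    rw [inner_sub_left, sum_inner]
    simp_rw [real_inner_smul_left, hb']
    simp [Finset.sum_ite_eq, Finset.mem_univ]
  have := key _ h
  rwa [sub_eq_zero] at this

omit [FiniteDimensional ℝ E] in
/-- Bilinear expansion: `B (∑ᵢ aᵢ bᵢ) (∑ₖ cₖ bₖ) = ∑ᵢ ∑ₖ (aᵢ cₖ) • B bᵢ bₖ`. [folklore] -/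
theorem bilin_sum_smul_sum_smul {ι : Type*} [Fintype ι] (B : E →L[ℝ] E →L[ℝ] F) (b : ι → E)
    (a c : ι → ℝ) :
    B (∑ i, a i • b i) (∑ k, c k • b k) = ∑ i, ∑ k, (a i * c k) • B (b i) (b k) := by
  have hB : ∀ w, B (∑ i, a i • b i) w = ∑ i, a i • B (b i) w := fun w => by
    simp only [map_sum, map_smul, FunLike.coe_sum, FunLike.coe_smul, Finset.sum_apply,
      Pi.smul_apply]
  rw [hB]
  refine Finset.sum_congr rfl fun i _ => ?_
  rw [map_sum, Finset.smul_sum]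
  refine Finset.sum_congr rfl fun k _ => ?_
  rw [map_smul, smul_smul]

omit [FiniteDimensional ℝ E] in
/-- **Trace in a `G`-orthonormal frame via the inverse operator**: with `b`, `G` as above, `G`
symmetric and `Ginv` a right inverse of `G` (`G (Ginv v) = v`), and `e` an orthonormal basis,
`∑ᵢ B bᵢ bᵢ = ∑ⱼ B (Ginv eⱼ) eⱼ` for every continuous bilinear `B`. [cite: White2005, §8.4] -/
theorem sum_frame_eq_sum_inverse_apply {ι κ : Type*} [Fintype ι] [DecidableEq ι] [Fintype κ]
    {G Ginv : E →L[ℝ] E}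
    (hGsymm : ∀ v w, ⟪G v, w⟫ = ⟪v, G w⟫) (hGinv : ∀ v, G (Ginv v) = v)
    (b : Basis ι ℝ E) (hb : ∀ i j, ⟪G (b i), b j⟫ = if i = j then 1 else 0)
    (e : OrthonormalBasis κ ℝ E) (B : E →L[ℝ] E →L[ℝ] F) :
    ∑ i, B (b i) (b i) = ∑ j, B (Ginv (e j)) (e j) := by
  -- `Ginv eⱼ = ∑ᵢ ⟪eⱼ, bᵢ⟫ bᵢ` and `eⱼ = ∑ₖ ⟪eⱼ, G bₖ⟫ bₖ`
  have h1 : ∀ j, Ginv (e j) = ∑ i, ⟪e j, b i⟫ • b i := fun j => by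
    have h := eq_sum_inner_frame b hb (Ginv (e j))
    have hcoef : ∀ i, ⟪Ginv (e j), G (b i)⟫ = ⟪e j, b i⟫ := fun i => by
      rw [← hGsymm, hGinv]
    simp_rw [hcoef] at h
    exact h
  have h2 : ∀ j, e j = ∑ k, ⟪e j, G (b k)⟫ • b k := fun j => eq_sum_inner_frame b hb (e j)
  -- expand the right-hand side
  have h3 : ∀ j, B (Ginv (e j)) (e j) =
      ∑ i, ∑ k, (⟪e j, b i⟫ * ⟪e j, G (b k)⟫) • B (b i) (b k) := fun j => by
    have := congrArg₂ (fun x y => B x y) (h1 j) (h2 j)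
    rw [this, bilin_sum_smul_sum_smul]
  simp_rw [h3]
  -- exchange the sums and use Parseval `∑ⱼ ⟪eⱼ, bᵢ⟫ ⟪eⱼ, G bₖ⟫ = ⟪bᵢ, G bₖ⟫`
  rw [Finset.sum_comm]
  refine Finset.sum_congr rfl fun i _ => ?_
  rw [Finset.sum_comm]
  have hpar : ∀ k, ∑ j, ⟪e j, b i⟫ * ⟪e j, G (b k)⟫ = ⟪b i, G (b k)⟫ := fun k => by
    have h0 : ∑ j, ⟪e j, b i⟫ * ⟪e j, G (b k)⟫ = ∑ j, ⟪b i, e j⟫ * ⟪e j, G (b k)⟫ :=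
      Finset.sum_congr rfl fun j _ => by rw [real_inner_comm (b i) (e j)]
    rw [h0]
    exact e.sum_inner_mul_inner (b i) (G (b k))
  have h4 : ∀ k, ∑ j, (⟪e j, b i⟫ * ⟪e j, G (b k)⟫) • B (b i) (b k) =
      ⟪b i, G (b k)⟫ • B (b i) (b k) := fun k => by
    rw [← Finset.sum_smul, hpar]
  simp_rw [h4]
  -- `⟪bᵢ, G bₖ⟫ = δₖᵢ`
  have h5 : ∀ k, ⟪b i, G (b k)⟫ = if k = i then 1 else 0 := fun k => by
    rw [real_inner_comm, hb]
  simp_rw [h5]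
  simp [Finset.sum_ite_eq', Finset.mem_univ]

/-! ### The Gram operator `G = 1 + D†D` of a graph map -/

section Gram

variable {V : Type*} [NormedAddCommGroup V] [InnerProductSpace ℝ V] [FiniteDimensional ℝ V]

/-- `⟪(1 + D†D) v, v⟫ = ‖v‖² + ‖D v‖²`. [folklore] -/
theorem inner_gram_apply_self (D : E →L[ℝ] V) (v : E) :
    ⟪(1 + D.adjoint ∘L D) v, v⟫ = ‖v‖ ^ 2 + ‖D v‖ ^ 2 := by
  rw [add_apply, inner_add_left, one_apply_eq_self,
    real_inner_self_eq_norm_sq, ContinuousLinearMap.comp_apply,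
    ContinuousLinearMap.adjoint_inner_left, real_inner_self_eq_norm_sq]

/-- The Gram operator is symmetric. [folklore] -/
theorem inner_gram_comm (D : E →L[ℝ] V) (v w : E) :
    ⟪(1 + D.adjoint ∘L D) v, w⟫ = ⟪v, (1 + D.adjoint ∘L D) w⟫ := by
  simp only [add_apply, one_apply_eq_self,
    ContinuousLinearMap.comp_apply, inner_add_left, inner_add_right,
    ContinuousLinearMap.adjoint_inner_left, ContinuousLinearMap.adjoint_inner_right]

/-- `‖v‖ ≤ ‖(1 + D†D) v‖`. [folklore] -/
theorem norm_le_norm_gram_apply (D : E →L[ℝ] V) (v : E) : ‖v‖ ≤ ‖(1 + D.adjoint ∘L D) v‖ := by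
  by_cases hv : v = 0
  · simp [hv]
  have hpos : 0 < ‖v‖ := norm_pos_iff.2 hv
  have h1 : ‖v‖ ^ 2 ≤ ⟪(1 + D.adjoint ∘L D) v, v⟫ := by
    rw [inner_gram_apply_self]; nlinarith [sq_nonneg ‖D v‖]
  have h2 : ⟪(1 + D.adjoint ∘L D) v, v⟫ ≤ ‖(1 + D.adjoint ∘L D) v‖ * ‖v‖ :=
    real_inner_le_norm _ _
  nlinarith

/-- **The Gram operator is invertible, with `‖G⁻¹‖ ≤ 1` and `‖G⁻¹ - 1‖ ≤ ‖D‖²`.** [folklore] -/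
theorem exists_gram_inverse (D : E →L[ℝ] V) :
    ∃ Ginv : E →L[ℝ] E, (∀ v, (1 + D.adjoint ∘L D) (Ginv v) = v) ∧
      (∀ v, Ginv ((1 + D.adjoint ∘L D) v) = v) ∧ ‖Ginv‖ ≤ 1 ∧ ‖Ginv - 1‖ ≤ ‖D‖ ^ 2 := by
  set G : E →L[ℝ] E := 1 + D.adjoint ∘L D with hG
  have hinj : Function.Injective G := by
    intro v w hvw
    have h := norm_le_norm_gram_apply D (v - w)
    rw [map_sub, hvw, sub_self, norm_zero, norm_le_zero_iff, sub_eq_zero] at h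
    exact h
  -- linear automorphism of a finite-dimensional space
  set e : E ≃ₗ[ℝ] E := LinearEquiv.ofInjectiveEndo G.toLinearMap hinj with he
  have heG : ∀ v, e v = G v := fun v => rfl
  set Ginv : E →L[ℝ] E := LinearMap.toContinuousLinearMap e.symm.toLinearMap with hGinv
  have h1 : ∀ v, G (Ginv v) = v := fun v => by
    rw [← heG]; exact e.apply_symm_apply v
  have h2 : ∀ v, Ginv (G v) = v := fun v => by
    change e.symm (G v) = v
    rw [← heG]; exact e.symm_apply_apply v
  have hnorm : ‖Ginv‖ ≤ 1 := by
    refine ContinuousLinearMap.opNorm_le_bound _ zero_le_one fun w => ?_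
    rw [one_mul]
    calc ‖Ginv w‖ ≤ ‖G (Ginv w)‖ := norm_le_norm_gram_apply D _
      _ = ‖w‖ := by rw [h1]
  refine ⟨Ginv, h1, h2, hnorm, ?_⟩
  -- `Ginv - 1 = -Ginv ∘ D†D`
  have hid : Ginv - 1 = -(Ginv ∘L (D.adjoint ∘L D)) := by
    ext w
    have h := h2 w
    rw [hG, add_apply, one_apply_eq_self, map_add] at h
    simp only [sub_apply, one_apply_eq_self,
      neg_apply, ContinuousLinearMap.comp_apply]
    have h' : Ginv w + Ginv (D.adjoint (D w)) = w := h
    rw [← sub_eq_zero] at h' ⊢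
    rw [← h']
    abel
  rw [hid, norm_neg]
  calc ‖Ginv ∘L (D.adjoint ∘L D)‖ ≤ ‖Ginv‖ * ‖D.adjoint ∘L D‖ :=
        ContinuousLinearMap.opNorm_comp_le _ _
    _ ≤ 1 * (‖D.adjoint‖ * ‖D‖) :=
        mul_le_mul hnorm (ContinuousLinearMap.opNorm_comp_le _ _) (norm_nonneg _) zero_le_one
    _ = ‖D‖ ^ 2 := by rw [one_mul, ContinuousLinearMap.adjoint.norm_map, sq]

/-- **Lipschitz dependence of the inverse Gram operator on `D`** (resolvent identity):
`‖G_D⁻¹ - G_{D'}⁻¹‖ ≤ (‖D‖ + ‖D'‖) ‖D - D'‖`. [folklore] -/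
theorem norm_gram_inverse_sub_le {D D' : E →L[ℝ] V} {Gi Gi' : E →L[ℝ] E}
    (h : ∀ v, Gi ((1 + D.adjoint ∘L D) v) = v) (hn : ‖Gi‖ ≤ 1)
    (h' : ∀ v, (1 + D'.adjoint ∘L D') (Gi' v) = v) (hn' : ‖Gi'‖ ≤ 1) :
    ‖Gi - Gi'‖ ≤ (‖D‖ + ‖D'‖) * ‖D - D'‖ := by
  -- `Gi - Gi' = Gi ∘ (G' - G) ∘ Gi'`
  have hid : Gi - Gi' = Gi ∘L ((1 + D'.adjoint ∘L D') - (1 + D.adjoint ∘L D)) ∘L Gi' := by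
    ext w
    simp only [sub_apply, ContinuousLinearMap.comp_apply, map_sub]
    rw [h (Gi' w), h' w]
  have hdiff : (1 + D'.adjoint ∘L D') - (1 + D.adjoint ∘L D) =
      D'.adjoint ∘L (D' - D) + (D' - D).adjoint ∘L D := by
    ext w
    simp only [sub_apply, add_apply,
      one_apply_eq_self, ContinuousLinearMap.comp_apply, map_sub]
    abel
  rw [hid, hdiff]
  calc ‖Gi ∘L (D'.adjoint ∘L (D' - D) + (D' - D).adjoint ∘L D) ∘L Gi'‖
      ≤ ‖Gi‖ * ‖D'.adjoint ∘L (D' - D) + (D' - D).adjoint ∘L D‖ * ‖Gi'‖ := by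
        calc _ ≤ ‖Gi ∘L (D'.adjoint ∘L (D' - D) + (D' - D).adjoint ∘L D)‖ * ‖Gi'‖ :=
              ContinuousLinearMap.opNorm_comp_le _ _
          _ ≤ _ := mul_le_mul_of_nonneg_right (ContinuousLinearMap.opNorm_comp_le _ _)
              (norm_nonneg _)
    _ ≤ 1 * (‖D'‖ * ‖D' - D‖ + ‖D' - D‖ * ‖D‖) * 1 := by
        refine mul_le_mul (mul_le_mul hn ?_ (norm_nonneg _) zero_le_one) hn' (norm_nonneg _)
          (by positivity)
        calc ‖D'.adjoint ∘L (D' - D) + (D' - D).adjoint ∘L D‖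
            ≤ ‖D'.adjoint ∘L (D' - D)‖ + ‖(D' - D).adjoint ∘L D‖ := norm_add_le _ _
          _ ≤ ‖D'.adjoint‖ * ‖D' - D‖ + ‖(D' - D).adjoint‖ * ‖D‖ :=
              add_le_add (ContinuousLinearMap.opNorm_comp_le _ _)
                (ContinuousLinearMap.opNorm_comp_le _ _)
          _ = ‖D'‖ * ‖D' - D‖ + ‖D' - D‖ * ‖D‖ := by
              rw [ContinuousLinearMap.adjoint.norm_map, ContinuousLinearMap.adjoint.norm_map]
    _ = (‖D‖ + ‖D'‖) * ‖D - D'‖ := by rw [norm_sub_rev D' D]; ring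

/-! #### The orthogonal projection onto the graph tangent space `T = range (L + D)` -/

/-- `(L + D)†(L + D) = 1 + D†D` for a linear isometry `L` and `D` with values in `(range L)ᗮ`.
[folklore] -/
theorem adjoint_graph_comp_graph (L : E →ₗᵢ[ℝ] V) {D : E →L[ℝ] V}
    (hD : ∀ v, D v ∈ (LinearMap.range L.toLinearMap)ᗮ) :
    (L.toContinuousLinearMap + D).adjoint ∘L (L.toContinuousLinearMap + D) =
      1 + D.adjoint ∘L D := by
  ext v
  refine ext_inner_right ℝ fun w => ?_
  simp only [ContinuousLinearMap.comp_apply, add_apply, one_apply_eq_self,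
    ContinuousLinearMap.adjoint_inner_left, inner_add_left, inner_add_right,
    LinearIsometry.coe_toContinuousLinearMap, L.inner_map_map]
  have h1 : ⟪(L v : V), D w⟫ = 0 := hD w (L v) ⟨v, rfl⟩
  have h2 : ⟪D v, (L w : V)⟫ = 0 := by
    rw [real_inner_comm]; exact hD v (L w) ⟨w, rfl⟩
  rw [h1, h2]; ring

/-- **The orthogonal projection onto `T = range (L + D)` is `(L + D) G⁻¹ (L + D)†`**, `G⁻¹` any
right inverse of the Gram operator `G = 1 + D†D`. [folklore] -/
theorem starProjection_range_graph_eq (L : E →ₗᵢ[ℝ] V) {D : E →L[ℝ] V}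
    (hD : ∀ v, D v ∈ (LinearMap.range L.toLinearMap)ᗮ) {Ginv : E →L[ℝ] E}
    (hGinv : ∀ v, (1 + D.adjoint ∘L D) (Ginv v) = v)
    [(LinearMap.range (L.toLinearMap + (D : E →ₗ[ℝ] V))).HasOrthogonalProjection] (w : V) :
    (LinearMap.range (L.toLinearMap + (D : E →ₗ[ℝ] V))).starProjection w =
      (L.toContinuousLinearMap + D) (Ginv ((L.toContinuousLinearMap + D).adjoint w)) := by
  set A : E →L[ℝ] V := L.toContinuousLinearMap + D with hA
  have hAT : ∀ v, A v ∈ LinearMap.range (L.toLinearMap + (D : E →ₗ[ℝ] V)) := fun v =>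
    ⟨v, by simp [hA]⟩
  refine Submodule.eq_starProjection_of_mem_of_inner_eq_zero (hAT _) fun z hz => ?_
  obtain ⟨v, rfl⟩ := hz
  have hv : (L.toLinearMap + (D : E →ₗ[ℝ] V)) v = A v := by simp [hA]
  -- `A† A = G`
  have hG : A.adjoint (A (Ginv (A.adjoint w))) = (1 + D.adjoint ∘L D) (Ginv (A.adjoint w)) := by
    have h := adjoint_graph_comp_graph L hD
    rw [← hA] at h
    exact congrArg (fun f : E →L[ℝ] E => f (Ginv (A.adjoint w))) h
  rw [hv, inner_sub_left, ← ContinuousLinearMap.adjoint_inner_left A v w,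
    ← ContinuousLinearMap.adjoint_inner_left A v (A (Ginv (A.adjoint w))), hG, hGinv, sub_self]

omit [FiniteDimensional ℝ E] [FiniteDimensional ℝ V] in
/-- Operator norm of the graph differential: `‖L + D‖ ≤ 1 + ‖D‖`. [folklore] -/
theorem norm_graph_le (L : E →ₗᵢ[ℝ] V) (D : E →L[ℝ] V) :
    ‖L.toContinuousLinearMap + D‖ ≤ 1 + ‖D‖ :=
  (norm_add_le _ _).trans (add_le_add L.norm_toContinuousLinearMap_le le_rfl)

/-- **Lipschitz dependence of the tangent projection on `D`**: with `P(D) = (L + D) G_D⁻¹ (L + D)†`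
and `‖D‖, ‖D'‖ ≤ 1`, `‖P(D) - P(D')‖ ≤ 12 ‖D - D'‖`. [folklore] -/
theorem norm_graphProjection_sub_le (L : E →ₗᵢ[ℝ] V) {D D' : E →L[ℝ] V} {Gi Gi' : E →L[ℝ] E}
    (h : ∀ v, Gi ((1 + D.adjoint ∘L D) v) = v) (hn : ‖Gi‖ ≤ 1)
    (h' : ∀ v, (1 + D'.adjoint ∘L D') (Gi' v) = v) (hn' : ‖Gi'‖ ≤ 1)
    (hD : ‖D‖ ≤ 1) (hD' : ‖D'‖ ≤ 1) :
    ‖(L.toContinuousLinearMap + D) ∘L Gi ∘L (L.toContinuousLinearMap + D).adjoint -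
        (L.toContinuousLinearMap + D') ∘L Gi' ∘L (L.toContinuousLinearMap + D').adjoint‖ ≤
      12 * ‖D - D'‖ := by
  set A : E →L[ℝ] V := L.toContinuousLinearMap + D with hA
  set A' : E →L[ℝ] V := L.toContinuousLinearMap + D' with hA'
  have hAA' : A - A' = D - D' := by rw [hA, hA']; abel
  have hnA : ‖A‖ ≤ 2 := (norm_graph_le L D).trans (by linarith)
  have hnA' : ‖A'‖ ≤ 2 := (norm_graph_le L D').trans (by linarith)
  have hGG : ‖Gi - Gi'‖ ≤ 2 * ‖D - D'‖ := by
    calc ‖Gi - Gi'‖ ≤ (‖D‖ + ‖D'‖) * ‖D - D'‖ := norm_gram_inverse_sub_le h hn h' hn'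
      _ ≤ (1 + 1) * ‖D - D'‖ := mul_le_mul_of_nonneg_right (add_le_add hD hD') (norm_nonneg _)
      _ = 2 * ‖D - D'‖ := by ring
  -- telescoping
  have hsplit : A ∘L Gi ∘L A.adjoint - A' ∘L Gi' ∘L A'.adjoint =
      (A - A') ∘L Gi ∘L A.adjoint + A' ∘L (Gi - Gi') ∘L A.adjoint +
        A' ∘L Gi' ∘L (A - A').adjoint := by
    ext w
    simp only [sub_apply, add_apply, ContinuousLinearMap.comp_apply, map_sub]
    abel
  rw [hsplit]
  have hadj : ∀ B : E →L[ℝ] V, ‖B.adjoint‖ = ‖B‖ := fun B => ContinuousLinearMap.adjoint.norm_map B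
  have t1 : ‖(A - A') ∘L Gi ∘L A.adjoint‖ ≤ ‖D - D'‖ * 1 * 2 := by
    calc _ ≤ ‖A - A'‖ * ‖Gi‖ * ‖A.adjoint‖ := by
          calc _ ≤ ‖(A - A') ∘L Gi‖ * ‖A.adjoint‖ := ContinuousLinearMap.opNorm_comp_le _ _
            _ ≤ _ := mul_le_mul_of_nonneg_right (ContinuousLinearMap.opNorm_comp_le _ _)
                (norm_nonneg _)
      _ ≤ ‖D - D'‖ * 1 * 2 := by
          rw [hAA', hadj]
          exact mul_le_mul (mul_le_mul_of_nonneg_left hn (norm_nonneg _)) hnA (norm_nonneg _)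
            (by positivity)
  have t2 : ‖A' ∘L (Gi - Gi') ∘L A.adjoint‖ ≤ 2 * (2 * ‖D - D'‖) * 2 := by
    calc _ ≤ ‖A'‖ * ‖Gi - Gi'‖ * ‖A.adjoint‖ := by
          calc _ ≤ ‖A' ∘L (Gi - Gi')‖ * ‖A.adjoint‖ := ContinuousLinearMap.opNorm_comp_le _ _
            _ ≤ _ := mul_le_mul_of_nonneg_right (ContinuousLinearMap.opNorm_comp_le _ _)
                (norm_nonneg _)
      _ ≤ 2 * (2 * ‖D - D'‖) * 2 := by
          rw [hadj]
          exact mul_le_mul (mul_le_mul hnA' hGG (norm_nonneg _) (by norm_num)) hnA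
            (norm_nonneg _) (by positivity)
  have t3 : ‖A' ∘L Gi' ∘L (A - A').adjoint‖ ≤ 2 * 1 * ‖D - D'‖ := by
    calc _ ≤ ‖A'‖ * ‖Gi'‖ * ‖(A - A').adjoint‖ := by
          calc _ ≤ ‖A' ∘L Gi'‖ * ‖(A - A').adjoint‖ := ContinuousLinearMap.opNorm_comp_le _ _
            _ ≤ _ := mul_le_mul_of_nonneg_right (ContinuousLinearMap.opNorm_comp_le _ _)
                (norm_nonneg _)
      _ ≤ 2 * 1 * ‖D - D'‖ := by
          rw [hadj, hAA']
          exact mul_le_mul (mul_le_mul hnA' hn' (norm_nonneg _) (by norm_num)) le_rfl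
            (norm_nonneg _) (by positivity)
  calc _ ≤ ‖(A - A') ∘L Gi ∘L A.adjoint + A' ∘L (Gi - Gi') ∘L A.adjoint‖ +
        ‖A' ∘L Gi' ∘L (A - A').adjoint‖ := norm_add_le _ _
    _ ≤ (‖(A - A') ∘L Gi ∘L A.adjoint‖ + ‖A' ∘L (Gi - Gi') ∘L A.adjoint‖) +
        ‖A' ∘L Gi' ∘L (A - A').adjoint‖ := add_le_add (norm_add_le _ _) le_rfl
    _ ≤ (‖D - D'‖ * 1 * 2 + 2 * (2 * ‖D - D'‖) * 2) + 2 * 1 * ‖D - D'‖ :=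
        add_le_add (add_le_add t1 t2) t3
    _ = 12 * ‖D - D'‖ := by ring

end Gram

end Literature.Geometry.Riemannian
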